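import Mathlib.RingTheory.PowerSeries.Log
import Literature.NumberTheory.Transcendental.PadicLogPrincipalUnits
import Literature.NumberTheory.LocalFields.PadicExpLogHomomorphisms
import HarnessLib

set_option autoImplicit false

/-!
# READ₂ cut, generic half: the reading glue on `(ℤ/N)ˣ`, the dyadic `Λ₂`-split `Λ₂(t) = ½·plog(1+2t)` on the CLOSED unit
# ball, and the series identity `logOf(1 + 2y) = 2•Λ₂(y)` with `Λ₂ ∈ ℤ₂⟦X⟧`

Cell `bsd-print-cf2`, discharge-interface typer `bsd-print-cf2-ty2` g45 (literature-prover seat; Summits-side helpers in the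
typer's directory `Rank1Residual/P2/`, Theses-free, no item): port P50 (part 1 of 2) of STUB-PLAN `stub_heegnerIndexLowerAtTwo`
(crux `PrintCf2.SplitBadTwoLowerHalfOfFacts`, stmt-BirchSwinnertonDyer-27851; CRITIC-ROWS-g41 row 117, node R219 «READ₂» with R221
«EVAL₂» closed in kernel; sketch k3-g40 `2333f3139e2b61f4` §1, §2, §5 VERBATIM). Part 2 (`…ReadTwoCutValues.lean`) carries §3–§4
(the tree-currency evaluation and the local untwist). HONEST FRAMING: nothing here proves BSD, the crux or the stub; no named
fact, no `sorry`; `RamifiedReading` / `UnitReading` are `Prop`-valued receptacles with explicit binders (k3-g38's consumer shape).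

* §1 GLUE (Mathlib-only): `RamifiedReading`, `UnitReading`, `ramifiedReading_of_unitReading` / `unitReading_of_ramifiedReading`,
  ★ `unitReading_of_cut`, `read₂_of_cut`, ★ `read₂_of_refl_cut` (the REFL presentation of record: `V₂` constant).
* §2 S4 = R221 «EVAL₂» at the value level (any complete ultrametric normed `ℚ₂`-algebra): `lamTerm`, `norm_lamTerm_le`,
  `summable_lamTerm`, `hasSum_lamTerm` (`Σ lamTerm t = ½·plog(1+2t)` on `‖t‖ ≤ 1`), `plog_sq_mul_inv`, `plog_eq_sub_of_mul_eq`,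
  `lambda_value_refl`, `lambda_value_split`.
* §3 G2, the SERIES identity (any `ℚ`-algebra): `Lam2`, `coeff_Lam2`, `two_smul_Lam2`, ★ `logOf_one_add_two_smul`, `coeff_Lam2_succ`,
  `logOf_subst`, `logOf_map`.

References: [deShalit1987] I.3.3 (7), (7′), (8) (p. 17), I.3.5 (11) (p. 18); Mathlib `PowerSeries.logOf`.
-/

noncomputable section

open scoped PowerSeries.WithPiTopology

namespace Summit.BirchSwinnertonDyer.Rank1Residual.P2.ReadTwoCut

/-! ## §1. The glue (Mathlib-only, PROVED): READ₂ ⟸ one identity on units ⟸ the four sub-stub value identities -/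

section Glue

variable {R' : Type*} [CommRing R'] {N : ℕ}

/-- `RamifiedReading` — VERBATIM the consumer's input (k3-g38 `atom_shape`): two-term structure + unit covariance. -/
def RamifiedReading {M : ℕ} (hMN : M ∣ N) (V V₁ : ZMod N → R') (V₂ : ZMod M → R')
    {Γ : Type*} (e : Γ ≃ (ZMod N)ˣ) (ℓ : Γ → R') : Prop :=
  (∀ j : ZMod N, V j = V₁ j - V₂ (ZMod.castHom hMN (ZMod M) j)) ∧ ∀ γ : Γ, V₁ (e γ : ZMod N) = ℓ γ

/-- **The content of READ₂ is ONE identity on units**: `V(eγ) + V₂(eγ mod M) = ℓ(γ)`. -/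
def UnitReading {M : ℕ} (hMN : M ∣ N) (V : ZMod N → R') (V₂ : ZMod M → R')
    {Γ : Type*} (e : Γ ≃ (ZMod N)ˣ) (ℓ : Γ → R') : Prop :=
  ∀ γ : Γ, V (e γ : ZMod N) + V₂ (ZMod.castHom hMN (ZMod M) (e γ : ZMod N)) = ℓ γ

/-- `UnitReading ⟹ RamifiedReading` with `V₁ := V + V₂ ∘ cast` (conjunct 1 becomes definitional). -/
theorem ramifiedReading_of_unitReading {M : ℕ} (hMN : M ∣ N) {V : ZMod N → R'} {V₂ : ZMod M → R'}
    {Γ : Type*} {e : Γ ≃ (ZMod N)ˣ} {ℓ : Γ → R'} (h : UnitReading hMN V V₂ e ℓ) :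
    RamifiedReading hMN V (fun j => V j + V₂ (ZMod.castHom hMN (ZMod M) j)) V₂ e ℓ :=
  ⟨fun _ => (add_sub_cancel_right _ _).symm, fun γ => h γ⟩

/-- … and conversely: ANY ramified reading yields the unit identity (so nothing is lost by the normal form). -/
theorem unitReading_of_ramifiedReading {M : ℕ} (hMN : M ∣ N) {V V₁ : ZMod N → R'} {V₂ : ZMod M → R'}
    {Γ : Type*} {e : Γ ≃ (ZMod N)ˣ} {ℓ : Γ → R'} (h : RamifiedReading hMN V V₁ V₂ e ℓ) :
    UnitReading hMN V V₂ e ℓ := fun γ => by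
  rw [h.1 (e γ : ZMod N), sub_add_cancel, h.2 γ]

/-- ★ **THE CUT GLUE `read₂_of_cut`.**  Value tables on `(ℤ/N)ˣ` (`N = 2^{n+1}`, `M = 2^n`):
`Λv a` = value of the primitive series `log̃ g_b ∘ ϑ` at `ζ^a − 1`; `Lg a = plog g_b(w_a)` (`w_a = ϑ(ζ^a−1)`);
`Lφ m = plog g_b^φ(w'_m)` (`w'_{a mod M} = f′(w_a)`, level `n`); `T γ` = the untwisted table (`log` of `σ_γ(b_n)`).
S1 (pullback, up to the period `Ω⁻¹` and an additive constant) + S4 (Λ-split) + S3 (transport: the `½`-term factors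
through `a mod M`) + S2 (untwist on units) ⟹ `UnitReading`, hence `RamifiedReading`. -/
theorem unitReading_of_cut {M : ℕ} (hMN : M ∣ N) {Γ : Type*} (e : Γ ≃ (ZMod N)ˣ)
    (V : ZMod N → R') (Λv Lg Lφ' : (ZMod N)ˣ → R') (Lφ : ZMod M → R') (T : Γ → R') (Ωinv half c : R')
    (hS1 : ∀ a : (ZMod N)ˣ, V (a : ZMod N) = Ωinv * Λv a + c)
    (hS4 : ∀ a : (ZMod N)ˣ, Λv a = Lg a - half * Lφ' a)
    (hS3 : ∀ a : (ZMod N)ˣ, Lφ' a = Lφ (ZMod.castHom hMN (ZMod M) (a : ZMod N)))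
    (hS2 : ∀ γ : Γ, Lg (e γ) = T γ) :
    UnitReading hMN V (fun m => Ωinv * half * Lφ m - c) e (fun γ => Ωinv * T γ) := fun γ => by
  simp only [hS1, hS4, hS3, hS2]
  ring

/-- READ₂ from the cut. -/
theorem read₂_of_cut {M : ℕ} (hMN : M ∣ N) {Γ : Type*} (e : Γ ≃ (ZMod N)ˣ)
    (V : ZMod N → R') (Λv Lg Lφ' : (ZMod N)ˣ → R') (Lφ : ZMod M → R') (T : Γ → R') (Ωinv half c : R')
    (hS1 : ∀ a : (ZMod N)ˣ, V (a : ZMod N) = Ωinv * Λv a + c)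
    (hS4 : ∀ a : (ZMod N)ˣ, Λv a = Lg a - half * Lφ' a)
    (hS3 : ∀ a : (ZMod N)ˣ, Lφ' a = Lφ (ZMod.castHom hMN (ZMod M) (a : ZMod N)))
    (hS2 : ∀ γ : Γ, Lg (e γ) = T γ) :
    RamifiedReading hMN V (fun j => V j + (Ωinv * half * Lφ (ZMod.castHom hMN (ZMod M) j) - c))
      (fun m => Ωinv * half * Lφ m - c) e (fun γ => Ωinv * T γ) :=
  ramifiedReading_of_unitReading hMN (unitReading_of_cut hMN e V Λv Lg Lφ' Lφ T Ωinv half c hS1 hS4 hS3 hS2)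

/-- ★ **THE CUT GLUE, REFL SHAPE (presentation of record, row 115: `V j = κ·(ℓ_j − ℓ_{j+s}) + c`, `s = 2^n`,
`V₂ = −c` CONSTANT).**  `Lg a = plog θ g_b(w_a)`; the shift `a ↦ a + s` is multiplication by a fixed `γ₀ ∈ Γ`
(`ζ^{a+2^n} = −ζ^a`, `γ₀ ↔ −1`); S1 (pullback + EVAL₂-REFL: `½·plog Q(w_a) = ½(ℓ_a − ℓ_{a+s})`) + S2 (untwist on
units) ⟹ `RamifiedReading` with constant `V₂`. -/
theorem read₂_of_refl_cut {M : ℕ} (hMN : M ∣ N) {Γ : Type*} [Mul Γ] (e : Γ ≃ (ZMod N)ˣ)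
    (V Lg : ZMod N → R') (T : Γ → R') (κ c : R') (s : ZMod N) (γ₀ : Γ)
    (hshift : ∀ γ : Γ, ((e (γ * γ₀) : (ZMod N)ˣ) : ZMod N) = (e γ : ZMod N) + s)
    (hS1 : ∀ a : ZMod N, V a = κ * (Lg a - Lg (a + s)) + c)
    (hS2 : ∀ γ : Γ, Lg (e γ : ZMod N) = T γ) :
    RamifiedReading hMN V (fun j : ZMod N => V j + -c) (fun _ : ZMod M => -c) e
      (fun γ => κ * (T γ - T (γ * γ₀))) := by
  have h : UnitReading hMN V (fun _ : ZMod M => -c) e (fun γ => κ * (T γ - T (γ * γ₀))) := fun γ => by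
    simp only [hS1, ← hshift, hS2]
    ring
  exact ramifiedReading_of_unitReading hMN h

end Glue

/-! ## §2. S4, the Λ-SPLIT at a point (PROVED, any complete ultrametric normed `ℚ₂`-algebra `𝕜`, e.g. `ℂ_[2]`):
`Λ₂(t) := Σ_{d≥0} (−1)^d 2^d t^{d+1}/(d+1) = ½·plog(1 + 2t)` CONVERGES on the CLOSED unit ball (`v₂(2^d/(d+1)) → ∞`),
and `x² = y·(1 + 2t)` with `x, y` principal units ⟹ `Λ₂(t) = plog x − ½·plog y`.  Only `plog` homomorphy and the
defining Mercator series are used — this is the whole "log / evaluation commutation" of READ₂ at the value level. -/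

section LambdaSplit

open Literature.NumberTheory.Transcendental

variable {𝕜 : Type*} [NontriviallyNormedField 𝕜] [NormedAlgebra ℚ_[2] 𝕜] [CompleteSpace 𝕜]

omit [CompleteSpace 𝕜] in
/-- `‖2‖ = ½` in a normed `ℚ₂`-algebra. -/
theorem norm_two : ‖(2 : 𝕜)‖ = 2⁻¹ := by
  have h := IwasawaLog.norm_natCast (F := 𝕜) 2 2
  have hp : ‖((2 : ℕ) : ℚ_[2])‖ = ((2 : ℕ) : ℝ)⁻¹ := Padic.norm_p
  simp only [Nat.cast_ofNat] at h hp
  rw [h, hp]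

omit [CompleteSpace 𝕜] in
/-- `2 ≠ 0` in a normed `ℚ₂`-algebra. -/
theorem two_ne_zero' : (2 : 𝕜) ≠ 0 := by
  intro h
  have := norm_two (𝕜 := 𝕜)
  rw [h, norm_zero] at this
  norm_num at this

/-- The terms of `Λ₂` at `t`: `(−1)^d · 2^d/(d+1) · t^{d+1}` (`= logScalar 2 (d+1) · t^{d+1}` in k1-g37's notation). -/
def lamTerm (t : 𝕜) (d : ℕ) : 𝕜 := (-1) ^ d * (2 : 𝕜) ^ d / ((d : 𝕜) + 1) * t ^ (d + 1)

omit [CompleteSpace 𝕜] in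
/-- Term bound on the CLOSED unit ball: `‖lamTerm t d‖ ≤ (d+1)·2^{−d}`. -/
theorem norm_lamTerm_le {t : 𝕜} (ht : ‖t‖ ≤ 1) (d : ℕ) :
    ‖lamTerm t d‖ ≤ ((d : ℝ) + 1) * (2⁻¹ : ℝ) ^ d := by
  unfold lamTerm
  have hinv : ‖((d : 𝕜) + 1)⁻¹‖ ≤ (d : ℝ) + 1 := by
    have h := IwasawaLog.norm_inv_natCast_le (F := 𝕜) 2 (n := d + 1) (Nat.succ_ne_zero d)
    push_cast at h
    exact h
  rw [div_eq_mul_inv, norm_mul, norm_mul, norm_mul, norm_pow, norm_pow, norm_neg, norm_one, one_pow, one_mul,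
    norm_two, norm_pow]
  calc (2⁻¹ : ℝ) ^ d * ‖((d : 𝕜) + 1)⁻¹‖ * ‖t‖ ^ (d + 1)
      ≤ (2⁻¹ : ℝ) ^ d * ((d : ℝ) + 1) * 1 := by
        gcongr
        exact pow_le_one₀ (norm_nonneg _) ht
    _ = ((d : ℝ) + 1) * (2⁻¹ : ℝ) ^ d := by ring

/-- `Λ₂(t)` converges for `‖t‖ ≤ 1`. -/
theorem summable_lamTerm {t : 𝕜} (ht : ‖t‖ ≤ 1) : Summable (lamTerm t) := by
  have hr : ‖(2⁻¹ : ℝ)‖ < 1 := by rw [norm_inv, Real.norm_ofNat]; norm_num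
  have hg : Summable fun d : ℕ => ((d : ℝ) + 1) * (2⁻¹ : ℝ) ^ d := by
    have h1 : Summable fun d : ℕ => ((d : ℝ) ^ 1) * (2⁻¹ : ℝ) ^ d := summable_pow_mul_geometric_of_norm_lt_one 1 hr
    have h0 : Summable fun d : ℕ => (2⁻¹ : ℝ) ^ d := summable_geometric_of_norm_lt_one hr
    simpa [pow_one, add_mul] using h1.add h0
  exact Summable.of_norm_bounded hg (norm_lamTerm_le ht)

omit [CompleteSpace 𝕜] in
/-- `½ · plog(1 + 2t) = Σ' lamTerm t` (rescaling the defining Mercator series termwise). -/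
theorem half_mul_plog_one_add_two_mul (t : 𝕜) :
    (2 : 𝕜)⁻¹ * PadicExp.plog (1 + 2 * t) = ∑' d, lamTerm t d := by
  rw [Literature.NumberTheory.LocalFields.plog_one_add_eq_tsum, ← tsum_mul_left]
  refine tsum_congr fun d => ?_
  unfold lamTerm
  have h2 : (2 : 𝕜) ≠ 0 := two_ne_zero'
  rw [mul_pow, pow_succ (2 : 𝕜)]
  field_simp

/-- ★ `HasSum (lamTerm t) (½ · plog (1 + 2t))` on the closed unit ball. -/
theorem hasSum_lamTerm {t : 𝕜} (ht : ‖t‖ ≤ 1) :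
    HasSum (lamTerm t) ((2 : 𝕜)⁻¹ * PadicExp.plog (1 + 2 * t)) := by
  rw [half_mul_plog_one_add_two_mul]
  exact (summable_lamTerm ht).hasSum

/-- `plog (x² · y⁻¹) = 2·plog x − plog y` on principal units. -/
theorem plog_sq_mul_inv [IsUltrametricDist 𝕜] {x y : 𝕜} (hx : ‖1 - x‖ < 1) (hy : ‖1 - y‖ < 1) :
    PadicExp.plog (x ^ 2 * y⁻¹) = 2 * PadicExp.plog x - PadicExp.plog y := by
  rw [PadicExp.plog_mul (ℓ := 2) (IwasawaLog.norm_one_sub_pow_lt hx 2) (IwasawaLog.norm_one_sub_inv_lt hy),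
    PadicExp.plog_pow (ℓ := 2) hx 2, PadicExp.plog_inv (ℓ := 2) hy]
  push_cast
  ring

/-- `plog` of a quotient of principal units: `q·r = x ⟹ plog q = plog x − plog r` (REFL form: `Q_β · τ_E g = g`
evaluated at a point). -/
theorem plog_eq_sub_of_mul_eq [IsUltrametricDist 𝕜] {x q r : 𝕜} (hq : ‖1 - q‖ < 1) (hr : ‖1 - r‖ < 1) (h : q * r = x) :
    PadicExp.plog q = PadicExp.plog x - PadicExp.plog r := by
  rw [← h, PadicExp.plog_mul (ℓ := 2) hq hr]
  ring

/-- ★ **S4, REFL FORM (row 114's witness `½·logOf V_β`, `V_β ≡ 1 (mod 2)` by H6): `P = 1 + 2t` ⟹ `Λ₂(t) = ½·plog P`**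
— the defining Mercator series on the closed ball, nothing else. -/
theorem lambda_value_refl {P t : 𝕜} (ht : ‖t‖ ≤ 1) (hP : P = 1 + 2 * t) :
    ∑' d, lamTerm t d = (2 : 𝕜)⁻¹ * PadicExp.plog P := by
  rw [hP]
  exact (hasSum_lamTerm ht).tsum_eq

/-- ★★ **S4 — THE Λ-SPLIT AT A POINT.**  `x = g(w)`, `y = g^φ(f′w)` principal units, `t = y_g(w)` integral with the
EVALUATED congruence `x² = y(1 + 2t)` (a ring-hom image of k1-g37's `exists_unitRatio` datum), and `L` the value of the
convergent integral series `Λ₂ ∘ y_g` at `w` (§3 identifies it with `Σ' lamTerm t`): then `L = plog x − ½ plog y`. -/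
theorem lambda_value_split [IsUltrametricDist 𝕜] {x y t L : 𝕜} (hx : ‖1 - x‖ < 1) (hy : ‖1 - y‖ < 1) (ht : ‖t‖ ≤ 1)
    (hfac : x ^ 2 = y * (1 + 2 * t)) (hL : HasSum (lamTerm t) L) :
    L = PadicExp.plog x - (2 : 𝕜)⁻¹ * PadicExp.plog y := by
  have hy1 : ‖y‖ = 1 := IwasawaLog.norm_eq_one_of_norm_one_sub_lt hy
  have hy0 : y ≠ 0 := by
    intro h; rw [h, norm_zero] at hy1; exact zero_ne_one hy1
  have h2 : (2 : 𝕜) ≠ 0 := two_ne_zero'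
  have hquot : 1 + 2 * t = x ^ 2 * y⁻¹ := by
    rw [hfac]; field_simp
  rw [hL.unique (hasSum_lamTerm ht), hquot, plog_sq_mul_inv hx hy]
  field_simp

end LambdaSplit

/-! ## §5. G2, the SERIES identity (PROVED, any ℚ-algebra): the reading witness of a series `≡ 1 (mod 2)` IS `Λ₂` of an
integral series — `logOf (1 + 2y) = 2 • Λ₂(y)`, `Λ₂ = ½·log(1 + 2X) ∈ ℤ₂⟦X⟧` (`2^{n−1}/n ∈ ℤ₂`).  This is what puts
R221 «EVAL₂» inside the tree's INTEGRAL evaluation calculus (`evS`, `evS_subst`): the outer series of the composite is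
`Λ₂` (integral), never Mercator's `log(1+X)` (coefficients `1/n`, unbounded). -/

section SeriesIdentity

open PowerSeries

variable (A : Type*) [CommRing A] [Algebra ℚ A]

/-- `Λ₂ := ½·log(1 + 2X) = Σ_{n ≥ 1} (−1)^{n+1} 2^{n−1}/n · X^n`. -/
def Lam2 : PowerSeries A :=
  PowerSeries.mk fun n => if n = 0 then 0 else algebraMap ℚ A ((-1 : ℚ) ^ (n + 1) * 2 ^ (n - 1) / n)

variable {A}

/-- The coefficients of `Λ₂`. -/
theorem coeff_Lam2 (n : ℕ) :
    coeff n (Lam2 A) = if n = 0 then 0 else algebraMap ℚ A ((-1 : ℚ) ^ (n + 1) * 2 ^ (n - 1) / n) :=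
  coeff_mk _ _

/-- `Λ₂(0) = 0`. -/
theorem constantCoeff_Lam2 : constantCoeff (Lam2 A) = 0 := by
  simp [← coeff_zero_eq_constantCoeff_apply, coeff_Lam2]

/-- `2 • Λ₂ = log(1 + 2X) = rescale 2 (log A)`. -/
theorem two_smul_Lam2 : (2 : A) • Lam2 A = rescale (2 : A) (log A) := by
  ext n
  rw [coeff_smul, coeff_rescale, coeff_Lam2, coeff_log]
  split_ifs with h
  · simp
  · obtain ⟨k, rfl⟩ := Nat.exists_eq_succ_of_ne_zero h
    rw [smul_eq_mul, show (2 : A) = algebraMap ℚ A 2 from (map_ofNat (algebraMap ℚ A) 2).symm, ← map_pow,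
      ← map_mul, ← map_mul, Nat.succ_eq_add_one, Nat.add_sub_cancel]
    congr 1
    rw [pow_succ]
    ring

/-- ★ **G2 (PROVED): `logOf (1 + 2y) = 2 • Λ₂(y)` for `y(0) = 0`.** -/
theorem logOf_one_add_two_smul {y : A⟦X⟧} (hy : constantCoeff y = 0) :
    logOf (1 + (2 : A) • y) = (2 : A) • (Lam2 A).subst y := by
  have hyS : HasSubst y := HasSubst.of_constantCoeff_zero' hy
  have h2X : HasSubst ((2 : A) • X : A⟦X⟧) := HasSubst.smul_X' 2
  rw [logOf_eq, add_sub_cancel_left, ← subst_smul hyS, two_smul_Lam2, rescale_eq_subst,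
    subst_comp_subst_apply h2X hyS, subst_smul hyS, subst_X hyS]

/-- The coefficients of `Λ₂` ARE the `lamTerm` scalars: `coeff (d+1) Λ₂ = (−1)^d 2^d/(d+1)` — so the `evS`-value of
`Λ₂(y)` at `w` (`tsum_coeff_subst_mul_pow_eq`: `= Σ_n coeff n Λ₂ · y(w)^n`) is `Σ' lamTerm (y(w))` after `θ`. -/
theorem coeff_Lam2_succ (d : ℕ) :
    coeff (d + 1) (Lam2 A) = algebraMap ℚ A ((-1 : ℚ) ^ d * 2 ^ d / (d + 1)) := by
  rw [coeff_Lam2, if_neg (Nat.succ_ne_zero d), Nat.add_sub_cancel]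
  congr 1
  push_cast
  ring

/-- G3a (PROVED): `logOf` commutes with substitution — `logOf (Q∘φ) = (logOf Q)∘φ`. -/
theorem logOf_subst {Q φ : A⟦X⟧} (hQ : constantCoeff Q = 1) (hφ : constantCoeff φ = 0) :
    logOf (Q.subst φ) = (logOf Q).subst φ := by
  have hφS : HasSubst φ := HasSubst.of_constantCoeff_zero' hφ
  have hQ1 : HasSubst (Q - 1 : A⟦X⟧) := HasSubst.of_constantCoeff_zero' (by simp [hQ])
  rw [logOf_eq, logOf_eq, subst_comp_subst_apply hQ1 hφS]
  congr 1
  rw [← coe_substAlgHom hφS, map_sub, map_one]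

/-- G3b (PROVED): `logOf` commutes with `map` along a ring hom (the transport `j`, then `Θ`). -/
theorem logOf_map {B : Type*} [CommRing B] [Algebra ℚ B] (h : A →+* B) {Q : A⟦X⟧}
    (hQ : constantCoeff Q = 1) : logOf (Q.map h) = (logOf Q).map h := by
  have hQ1 : HasSubst (Q - 1 : A⟦X⟧) := HasSubst.of_constantCoeff_zero' (by simp [hQ])
  rw [logOf_eq, logOf_eq]
  change _ = MvPowerSeries.map h (PowerSeries.subst (Q - 1) (log A))
  rw [map_subst hQ1, map_log]
  congr 1
  change _ = PowerSeries.map h (Q - 1)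
  rw [map_sub, map_one]

end SeriesIdentity

end Summit.BirchSwinnertonDyer.Rank1Residual.P2.ReadTwoCut

end
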